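import Literature.Analysis.FunctionSpaces.Mollification
import Mathlib.MeasureTheory.Integral.CurveIntegral.Poincare
import Mathlib.Analysis.InnerProductSpace.PiL2
import Mathlib.Analysis.InnerProductSpace.LinearMap
import HarnessLib

/-!
# Crux `BlockLipschitzL` (stmt-QuantumFields-23533) ∕ `HistoryTailL` (stmt-QuantumFields-19936), LINE 25 «CompactnessTransfer»,
# the (TM) discharge ROAD (H) «SU(2) currents ⇒ H-system ⇒ 8π quantum», brick (H) — file H1 «PLANAR STREAM FUNCTION: LETTERS»

Cell `ym3-torus` (YM ladder rung R3 = continuum SU(2) Yang–Mills on T³ — a RUNG, NOT Clay: not d = 4, not infinite volume,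
not a mass gap); WIDTH helper seat `ym3-torus-px5` g9 (brick (H) of px19 g8's road memo `ROAD-TM-HSYSTEM-px19g8.md`, released by
★w3 g15 16:02Z); `--supports stmt-QuantumFields-23533`; THEOREMS ONLY (0 `def`, 0 `sorry`, default heartbeats); imports lit
✓`Literature.Analysis.FunctionSpaces.Mollification` (weak derivatives ∕ mollifiers) + Mathlib's Poincaré lemma for closed `1`-forms on
convex sets (`Convex.exists_forall_hasFDerivAt_of_fderiv_symmetric`).

WHAT THIS FILE DOES (the smooth half of the planar stream function; `E² = EuclideanSpace ℝ (Fin 2)`, `e k = EuclideanSpace.single k 1`):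
* §1 coordinates on `E²` (the two-term expansions used throughout);
* §2 ★★ `exists_potential_of_curlFree` — a `C¹` planar field `(W₀, W₁)` with `∂₁W₀ = ∂₀W₁` has a `C¹` potential `f`, `∇f = (W₀, W₁)`
  (Mathlib's Poincaré lemma on the convex open set `univ`, the symmetry of `D(innerSL ∘ W)` being the curl condition in coordinates);
* §3 mollified scalar functions: smoothness and ★ `fderiv_mollify_apply` — `∂_v(ρ ⋆ g)(a) = ∫ ∂_vρ(a − y)·g(y) dy`;
* §4 ★★ `exists_potential_mollified_rot` — for a locally integrable planar field `A` that is WEAKLY DIVERGENCE-FREE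
  (`∫ Σ_k ∂_kη·A_k = 0` for all test `η`) and every test kernel `ρ`, the mollified ROTATED field `(−ρ ⋆ A₁, ρ ⋆ A₀)` is classically
  curl-free (`sum_fderiv_mollify_eq_zero`: the mollified divergence vanishes identically), hence has a `C¹` potential `f_ρ` with
  `∂_v f_ρ(a) = −(ρ ⋆ A₁)(a)·v₀ + (ρ ⋆ A₀)(a)·v₁`.
File H2 (`…PlanarStreamFunction`) passes to the limit `ρ → δ` and produces the `W^{1,1}_loc` stream function with `∇B = A⊥ ∈ L²`.
HONEST SCOPE.  Calculus∕measure letters; nothing of (TM), (ZD), (C), S1″, K1, `MeanDeviationL`, `BlockLipschitzL`, `HistoryTailL` is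
proved here.  YM₃ on T³ is rung R3, not Clay; YM gap NOT proved; no summit statement is proved here.

References: L. C. Evans, Partial Differential Equations, 2nd ed. (2010), §5.3.1 Thm. 1 and App. C.4 (mollifiers) [Evans2010];
V. Girault, P.-A. Raviart, Finite Element Methods for Navier–Stokes Equations (1986), Ch. I §3.1, Thm. 3.1 (stream functions of
divergence-free planar fields) [GiraultRaviart1986]; M. Spivak, Calculus on Manifolds (1965), Thm. 4-11 (Poincaré lemma) [Spivak1965].
-/

set_option autoImplicit false

noncomputable section

open scoped BigOperators Topology ContDiff Convolution InnerProductSpace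
open MeasureTheory Set Filter Function TopologicalSpace ContinuousLinearMap

namespace Summit.QuantumFields.YangMills.Theorems.PoincareLipschitzPlanarStreamFunctionLetters

open Literature.Analysis.FunctionSpaces (IsTestFunctionOn HasWeakFDerivOn)

/-! ## §1 Coordinates on `E²` -/

/-- Components of `c₀·e₀ + c₁·e₁`. [folklore] -/
theorem vec2_apply_zero (c₀ c₁ : ℝ) :
    (c₀ • EuclideanSpace.single (0 : Fin 2) (1:ℝ) + c₁ • EuclideanSpace.single (1 : Fin 2) (1:ℝ)) 0 = c₀ := by
  simp

/-- Components of `c₀·e₀ + c₁·e₁`. [folklore] -/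
theorem vec2_apply_one (c₀ c₁ : ℝ) :
    (c₀ • EuclideanSpace.single (0 : Fin 2) (1:ℝ) + c₁ • EuclideanSpace.single (1 : Fin 2) (1:ℝ)) 1 = c₁ := by
  simp

/-- `⟪c₀·e₀ + c₁·e₁, y⟫ = c₀·y₀ + c₁·y₁`. [folklore] -/
theorem inner_vec2 (c₀ c₁ : ℝ) (y : EuclideanSpace ℝ (Fin 2)) :
    ⟪c₀ • EuclideanSpace.single (0 : Fin 2) (1:ℝ) + c₁ • EuclideanSpace.single (1 : Fin 2) (1:ℝ), y⟫_ℝ = c₀ * y 0 + c₁ * y 1 := by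
  rw [inner_add_left, real_inner_smul_left, real_inner_smul_left, EuclideanSpace.inner_single_left,
    EuclideanSpace.inner_single_left]
  simp

/-- `‖c₀·e₀ + c₁·e₁‖² = c₀² + c₁²`. [folklore] -/
theorem norm_vec2_sq (c₀ c₁ : ℝ) :
    ‖c₀ • EuclideanSpace.single (0 : Fin 2) (1:ℝ) + c₁ • EuclideanSpace.single (1 : Fin 2) (1:ℝ)‖ ^ 2 = c₀ ^ 2 + c₁ ^ 2 := by
  rw [EuclideanSpace.real_norm_sq_eq, Fin.sum_univ_two, vec2_apply_zero, vec2_apply_one]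

/-- The two-term expansion `x = x₀·e₀ + x₁·e₁`. [folklore] -/
theorem eq_vec2 (x : EuclideanSpace ℝ (Fin 2)) :
    x = x 0 • EuclideanSpace.single (0 : Fin 2) (1:ℝ) + x 1 • EuclideanSpace.single (1 : Fin 2) (1:ℝ) := by
  ext i
  fin_cases i <;> simp

/-- A linear functional in coordinates: `D x = x₀·D e₀ + x₁·D e₁`. [folklore] -/
theorem clm_apply_eq_vec2 (D : EuclideanSpace ℝ (Fin 2) →L[ℝ] ℝ) (x : EuclideanSpace ℝ (Fin 2)) :
    D x = x 0 * D (EuclideanSpace.single (0 : Fin 2) (1:ℝ)) + x 1 * D (EuclideanSpace.single (1 : Fin 2) (1:ℝ)) := by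
  conv_lhs => rw [eq_vec2 x]
  rw [map_add, map_smul, map_smul, smul_eq_mul, smul_eq_mul]

/-- **THE CURL CONDITION IS THE SYMMETRY OF THE JACOBIAN**: for linear functionals `D₀, D₁` (the differentials of the two components
of a planar field) with `D₀ e₁ = D₁ e₀`, the bilinear form `(x, y) ↦ D₀(x)·y₀ + D₁(x)·y₁` is symmetric. [folklore] -/
theorem bilin_symm_of_curl (D₀ D₁ : EuclideanSpace ℝ (Fin 2) →L[ℝ] ℝ)
    (h : D₀ (EuclideanSpace.single (1 : Fin 2) (1:ℝ)) = D₁ (EuclideanSpace.single (0 : Fin 2) (1:ℝ)))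
    (x y : EuclideanSpace ℝ (Fin 2)) :
    D₀ x * y 0 + D₁ x * y 1 = D₀ y * x 0 + D₁ y * x 1 := by
  rw [clm_apply_eq_vec2 D₀ x, clm_apply_eq_vec2 D₁ x, clm_apply_eq_vec2 D₀ y, clm_apply_eq_vec2 D₁ y, h]
  ring

/-! ## §2 A `C¹` curl-free planar field has a potential -/

/-- The planar field assembled from two `C¹` components is `C¹`, with the expected differential. [folklore] -/
theorem hasFDerivAt_vec2 {W₀ W₁ : EuclideanSpace ℝ (Fin 2) → ℝ} (h₀ : ContDiff ℝ 1 W₀) (h₁ : ContDiff ℝ 1 W₁)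
    (a : EuclideanSpace ℝ (Fin 2)) :
    HasFDerivAt (fun a => W₀ a • EuclideanSpace.single (0 : Fin 2) (1:ℝ) + W₁ a • EuclideanSpace.single (1 : Fin 2) (1:ℝ))
      ((fderiv ℝ W₀ a).smulRight (EuclideanSpace.single (0 : Fin 2) (1:ℝ)) +
        (fderiv ℝ W₁ a).smulRight (EuclideanSpace.single (1 : Fin 2) (1:ℝ))) a := by
  have hd₀ : HasFDerivAt W₀ (fderiv ℝ W₀ a) a := ((h₀.differentiable (by norm_num)) a).hasFDerivAt
  have hd₁ : HasFDerivAt W₁ (fderiv ℝ W₁ a) a := ((h₁.differentiable (by norm_num)) a).hasFDerivAt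
  exact (hd₀.smul_const _).add (hd₁.smul_const _)

/-- ★★ **A `C¹` CURL-FREE PLANAR FIELD HAS A `C¹` POTENTIAL.**  If `W₀, W₁ : E² → ℝ` are `C¹` with `∂₁W₀ = ∂₀W₁` everywhere, there is
`f : E² → ℝ` with `Df(a) = ⟪(W₀(a), W₁(a)), ·⟫` at every `a` (Mathlib's Poincaré lemma for the closed `1`-form `a ↦ ⟪W(a), ·⟫` on the convex
open set `univ`: its differential `(x, y) ↦ DW₀(a)x·y₀ + DW₁(a)x·y₁` is symmetric exactly when `∂₁W₀ = ∂₀W₁`). [cite: Spivak1965, Thm. 4-11] -/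
theorem exists_potential_of_curlFree {W₀ W₁ : EuclideanSpace ℝ (Fin 2) → ℝ} (h₀ : ContDiff ℝ 1 W₀) (h₁ : ContDiff ℝ 1 W₁)
    (hcurl : ∀ a, fderiv ℝ W₀ a (EuclideanSpace.single (1 : Fin 2) (1:ℝ)) = fderiv ℝ W₁ a (EuclideanSpace.single (0 : Fin 2) (1:ℝ))) :
    ∃ f : EuclideanSpace ℝ (Fin 2) → ℝ, ∀ a, HasFDerivAt f
      (innerSL ℝ (W₀ a • EuclideanSpace.single (0 : Fin 2) (1:ℝ) + W₁ a • EuclideanSpace.single (1 : Fin 2) (1:ℝ))) a := by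
  -- the `1`-form and its differential
  set Wv : EuclideanSpace ℝ (Fin 2) → EuclideanSpace ℝ (Fin 2) :=
    fun a => W₀ a • EuclideanSpace.single (0 : Fin 2) (1:ℝ) + W₁ a • EuclideanSpace.single (1 : Fin 2) (1:ℝ) with hWv
  set omg : EuclideanSpace ℝ (Fin 2) → EuclideanSpace ℝ (Fin 2) →L[ℝ] ℝ := fun a => innerSL ℝ (Wv a) with homg
  have hWvd : ∀ a, HasFDerivAt Wv ((fderiv ℝ W₀ a).smulRight (EuclideanSpace.single (0 : Fin 2) (1:ℝ)) +
      (fderiv ℝ W₁ a).smulRight (EuclideanSpace.single (1 : Fin 2) (1:ℝ))) a := fun a => hasFDerivAt_vec2 h₀ h₁ a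
  have homgd : ∀ a, HasFDerivAt omg ((innerSL ℝ : EuclideanSpace ℝ (Fin 2) →L[ℝ] EuclideanSpace ℝ (Fin 2) →L[ℝ] ℝ).comp
      ((fderiv ℝ W₀ a).smulRight (EuclideanSpace.single (0 : Fin 2) (1:ℝ)) +
        (fderiv ℝ W₁ a).smulRight (EuclideanSpace.single (1 : Fin 2) (1:ℝ)))) a :=
    fun a => (innerSL ℝ).hasFDerivAt.comp a (hWvd a)
  have homgdiff : DifferentiableOn ℝ omg univ := fun a _ => (homgd a).differentiableAt.differentiableWithinAt
  have hsymm : ∀ a ∈ (univ : Set (EuclideanSpace ℝ (Fin 2))), ∀ x y, fderiv ℝ omg a x y = fderiv ℝ omg a y x := by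
    intro a _ x y
    rw [(homgd a).fderiv]
    simp only [ContinuousLinearMap.coe_comp, Function.comp_apply, _root_.add_apply,
      ContinuousLinearMap.smulRight_apply, innerSL_apply_apply, inner_vec2]
    exact bilin_symm_of_curl (fderiv ℝ W₀ a) (fderiv ℝ W₁ a) (hcurl a) x y
  obtain ⟨f, hf⟩ := convex_univ.exists_forall_hasFDerivAt_of_fderiv_symmetric isOpen_univ homgdiff hsymm
  exact ⟨f, fun a => hf a (mem_univ a)⟩

/-- The potential's directional derivatives and regularity: `∂_v f(a) = W₀(a)·v₀ + W₁(a)·v₁`, `f ∈ C¹`. [folklore] -/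
theorem potential_props {W₀ W₁ : EuclideanSpace ℝ (Fin 2) → ℝ} (h₀ : ContDiff ℝ 1 W₀) (h₁ : ContDiff ℝ 1 W₁)
    {f : EuclideanSpace ℝ (Fin 2) → ℝ} (hf : ∀ a, HasFDerivAt f
      (innerSL ℝ (W₀ a • EuclideanSpace.single (0 : Fin 2) (1:ℝ) + W₁ a • EuclideanSpace.single (1 : Fin 2) (1:ℝ))) a) :
    ContDiff ℝ 1 f ∧ (∀ a v, fderiv ℝ f a v = W₀ a * v 0 + W₁ a * v 1) ∧
      ∀ a, ‖fderiv ℝ f a‖ ^ 2 = W₀ a ^ 2 + W₁ a ^ 2 := by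
  have hfd : ∀ a, fderiv ℝ f a =
      innerSL ℝ (W₀ a • EuclideanSpace.single (0 : Fin 2) (1:ℝ) + W₁ a • EuclideanSpace.single (1 : Fin 2) (1:ℝ)) :=
    fun a => (hf a).fderiv
  refine ⟨?_, fun a v => ?_, fun a => ?_⟩
  · rw [contDiff_one_iff_fderiv]
    refine ⟨fun a => (hf a).differentiableAt, ?_⟩
    have : fderiv ℝ f = fun a =>
        innerSL ℝ (W₀ a • EuclideanSpace.single (0 : Fin 2) (1:ℝ) + W₁ a • EuclideanSpace.single (1 : Fin 2) (1:ℝ)) := funext hfd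
    rw [this]
    exact (innerSL ℝ).continuous.comp ((h₀.continuous.smul continuous_const).add (h₁.continuous.smul continuous_const))
  · rw [hfd a, innerSL_apply_apply, inner_vec2]
  · rw [hfd a, innerSL_apply_norm, norm_vec2_sq]

/-! ## §3 Mollified scalar functions -/

/-- Mollification by a test kernel is smooth (Mathlib `HasCompactSupport.contDiff_convolution_left`, for locally integrable `g`).
[cite: Evans2010, App. C.4 Thm. 7] -/
theorem contDiff_mollify {ρ : EuclideanSpace ℝ (Fin 2) → ℝ} (hρ : IsTestFunctionOn (⊤ : Opens (EuclideanSpace ℝ (Fin 2))) ρ)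
    {g : EuclideanSpace ℝ (Fin 2) → ℝ} (hg : LocallyIntegrable g volume) {n : ℕ∞} :
    ContDiff ℝ n (ρ ⋆[lsmul ℝ ℝ, volume] g) :=
  hρ.hasCompactSupport.contDiff_convolution_left _ (hρ.contDiff.of_le (by exact_mod_cast le_top)) hg

/-- ★ **DERIVATIVE OF A MOLLIFICATION**: `∂_v(ρ ⋆ g)(a) = ∫ ∂_vρ(a − y)·g(y) dy` for a test kernel `ρ` and locally integrable `g`
(Mathlib `HasCompactSupport.hasFDerivAt_convolution_left`, unpacked). [cite: Evans2010, App. C.4 Thm. 7] -/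
theorem fderiv_mollify_apply {ρ : EuclideanSpace ℝ (Fin 2) → ℝ} (hρ : IsTestFunctionOn (⊤ : Opens (EuclideanSpace ℝ (Fin 2))) ρ)
    {g : EuclideanSpace ℝ (Fin 2) → ℝ} (hg : LocallyIntegrable g volume) (a v : EuclideanSpace ℝ (Fin 2)) :
    fderiv ℝ (ρ ⋆[lsmul ℝ ℝ, volume] g) a v = ∫ y, fderiv ℝ ρ (a - y) v * g y := by
  have hρ1 : ContDiff ℝ 1 ρ := hρ.contDiff.of_le (by exact_mod_cast le_top)
  have hρc : HasCompactSupport ρ := hρ.hasCompactSupport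
  have hD := hρc.hasFDerivAt_convolution_left (lsmul ℝ ℝ) hρ1 hg a
  rw [hD.fderiv]
  have hint : ConvolutionExistsAt (fderiv ℝ ρ) g a
      ((lsmul ℝ ℝ : ℝ →L[ℝ] ℝ →L[ℝ] ℝ).precompL (EuclideanSpace ℝ (Fin 2))) volume :=
    (hρc.fderiv ℝ).convolutionExists_left _ (hρ1.continuous_fderiv one_ne_zero) hg a
  rw [convolution_def, ContinuousLinearMap.integral_apply hint.integrable v]
  simp only [precompL_apply, lsmul_apply, smul_eq_mul]
  rw [← integral_sub_left_eq_self (fun t => fderiv ℝ ρ t v * g (a - t)) volume a]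
  simp only [sub_sub_cancel]

/-- The integrand of `fderiv_mollify_apply` is integrable (continuous compactly supported weight against a locally integrable `g`).
[folklore] -/
theorem integrable_fderiv_kernel_mul {ρ : EuclideanSpace ℝ (Fin 2) → ℝ}
    (hρ : IsTestFunctionOn (⊤ : Opens (EuclideanSpace ℝ (Fin 2))) ρ) {g : EuclideanSpace ℝ (Fin 2) → ℝ}
    (hg : LocallyIntegrable g volume) (a v : EuclideanSpace ℝ (Fin 2)) :
    Integrable (fun y => fderiv ℝ ρ (a - y) v * g y) volume := by
  have hρ1 : ContDiff ℝ 1 ρ := hρ.contDiff.of_le (by exact_mod_cast le_top)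
  have hη : IsTestFunctionOn (⊤ : Opens (EuclideanSpace ℝ (Fin 2))) (fun y => ρ (a - y)) := hρ.comp_sub_left a
  have hcont : Continuous fun y => fderiv ℝ (fun z => ρ (a - z)) y v :=
    ((hη.contDiff.continuous_fderiv (by simp)).clm_apply continuous_const)
  have hsupp : HasCompactSupport fun y => fderiv ℝ (fun z => ρ (a - z)) y v :=
    (hη.hasCompactSupport.fderiv ℝ).mono fun y hy => by
      simp only [Function.mem_support, ne_eq] at hy ⊢
      intro h; exact hy (by rw [h, _root_.zero_apply])
  have h := hg.integrable_smul_left_of_hasCompactSupport hcont hsupp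
  simp only [smul_eq_mul] at h
  have heq : ∀ y, fderiv ℝ (fun z => ρ (a - z)) y v * g y = -(fderiv ℝ ρ (a - y) v * g y) := by
    intro y
    rw [Literature.Analysis.FunctionSpaces.fderiv_comp_sub_left_apply hρ1]
    ring
  simp_rw [heq] at h
  simpa using h.neg

/-! ## §4 The mollified rotated field of a weakly divergence-free field is curl-free -/

/-- ★ **THE MOLLIFIED DIVERGENCE VANISHES**: if the planar field `A` (components locally integrable) is weakly divergence-free,
`∫ Σ_k ∂_kη·A_k = 0` for every smooth compactly supported `η`, then for every test kernel `ρ` and every point `a`,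
`∂₀(ρ ⋆ A₀)(a) + ∂₁(ρ ⋆ A₁)(a) = 0` (test the identity against `η = ρ(a − ·)`). [cite: Evans2010, §5.3.1 Thm. 1] -/
theorem sum_fderiv_mollify_eq_zero {A : EuclideanSpace ℝ (Fin 2) → EuclideanSpace ℝ (Fin 2)}
    (hA : ∀ k : Fin 2, LocallyIntegrable (fun y => A y k) volume)
    (hdiv : ∀ η : EuclideanSpace ℝ (Fin 2) → ℝ, ContDiff ℝ ∞ η → HasCompactSupport η →
      ∫ y, ∑ k : Fin 2, fderiv ℝ η y (EuclideanSpace.single k (1:ℝ)) * A y k = 0)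
    {ρ : EuclideanSpace ℝ (Fin 2) → ℝ} (hρ : IsTestFunctionOn (⊤ : Opens (EuclideanSpace ℝ (Fin 2))) ρ)
    (a : EuclideanSpace ℝ (Fin 2)) :
    ∑ k : Fin 2, fderiv ℝ (ρ ⋆[lsmul ℝ ℝ, volume] fun y => A y k) a (EuclideanSpace.single k (1:ℝ)) = 0 := by
  have hρ1 : ContDiff ℝ 1 ρ := hρ.contDiff.of_le (by exact_mod_cast le_top)
  have hη : IsTestFunctionOn (⊤ : Opens (EuclideanSpace ℝ (Fin 2))) (fun y => ρ (a - y)) := hρ.comp_sub_left a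
  have key := hdiv (fun y => ρ (a - y)) hη.contDiff hη.hasCompactSupport
  -- each summand of the weak identity is integrable, so the sum commutes with the integral
  have hint : ∀ k : Fin 2, Integrable (fun y => fderiv ℝ (fun z => ρ (a - z)) y (EuclideanSpace.single k (1:ℝ)) * A y k) volume := by
    intro k
    have h := integrable_fderiv_kernel_mul hρ (hA k) a (EuclideanSpace.single k (1:ℝ))
    have heq : ∀ y, fderiv ℝ (fun z => ρ (a - z)) y (EuclideanSpace.single k (1:ℝ)) * A y k =
        -(fderiv ℝ ρ (a - y) (EuclideanSpace.single k (1:ℝ)) * A y k) := by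
      intro y
      rw [Literature.Analysis.FunctionSpaces.fderiv_comp_sub_left_apply hρ1]
      ring
    simp_rw [heq]
    exact h.neg
  rw [integral_finsetSum _ (fun k _ => hint k)] at key
  simp_rw [fderiv_mollify_apply hρ (hA _)]
  have hneg : ∀ k : Fin 2, ∫ y, fderiv ℝ (fun z => ρ (a - z)) y (EuclideanSpace.single k (1:ℝ)) * A y k =
      -∫ y, fderiv ℝ ρ (a - y) (EuclideanSpace.single k (1:ℝ)) * A y k := by
    intro k
    rw [← integral_neg]
    refine integral_congr_ae (ae_of_all _ fun y => ?_)
    beta_reduce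
    rw [Literature.Analysis.FunctionSpaces.fderiv_comp_sub_left_apply hρ1]
    ring
  simp_rw [hneg] at key
  rw [Fin.sum_univ_two] at key ⊢
  linarith

/-- ★★ **THE MOLLIFIED ROTATED FIELD HAS A POTENTIAL.**  For `A` as in `sum_fderiv_mollify_eq_zero` and a test kernel `ρ`, the smooth
planar field `(W₀, W₁) := (−ρ ⋆ A₁, ρ ⋆ A₀)` satisfies `∂₁W₀ = ∂₀W₁`, so it has a `C¹` potential `f` with
`∂_v f(a) = −(ρ ⋆ A₁)(a)·v₀ + (ρ ⋆ A₀)(a)·v₁` and `‖Df(a)‖² = (ρ ⋆ A₀)(a)² + (ρ ⋆ A₁)(a)²`.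
[cite: GiraultRaviart1986, Ch. I Thm. 3.1; Spivak1965, Thm. 4-11] -/
theorem exists_potential_mollified_rot {A : EuclideanSpace ℝ (Fin 2) → EuclideanSpace ℝ (Fin 2)}
    (hA : ∀ k : Fin 2, LocallyIntegrable (fun y => A y k) volume)
    (hdiv : ∀ η : EuclideanSpace ℝ (Fin 2) → ℝ, ContDiff ℝ ∞ η → HasCompactSupport η →
      ∫ y, ∑ k : Fin 2, fderiv ℝ η y (EuclideanSpace.single k (1:ℝ)) * A y k = 0)
    {ρ : EuclideanSpace ℝ (Fin 2) → ℝ} (hρ : IsTestFunctionOn (⊤ : Opens (EuclideanSpace ℝ (Fin 2))) ρ) :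
    ∃ f : EuclideanSpace ℝ (Fin 2) → ℝ, ContDiff ℝ 1 f ∧
      ∀ a, HasFDerivAt f (innerSL ℝ
        ((-(ρ ⋆[lsmul ℝ ℝ, volume] fun y => A y 1) a) • EuclideanSpace.single (0 : Fin 2) (1:ℝ) +
          (ρ ⋆[lsmul ℝ ℝ, volume] fun y => A y 0) a • EuclideanSpace.single (1 : Fin 2) (1:ℝ))) a := by
  set M₀ : EuclideanSpace ℝ (Fin 2) → ℝ := ρ ⋆[lsmul ℝ ℝ, volume] fun y => A y 0 with hM₀
  set M₁ : EuclideanSpace ℝ (Fin 2) → ℝ := ρ ⋆[lsmul ℝ ℝ, volume] fun y => A y 1 with hM₁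
  have hM₀s : ContDiff ℝ 1 M₀ := contDiff_mollify hρ (hA 0)
  have hM₁s : ContDiff ℝ 1 M₁ := contDiff_mollify hρ (hA 1)
  have hW₀s : ContDiff ℝ 1 (fun a => -M₁ a) := hM₁s.neg
  -- the curl condition `∂₁(−M₁) = ∂₀ M₀` is the vanishing of the mollified divergence
  have hcurl : ∀ a, fderiv ℝ (fun a => -M₁ a) a (EuclideanSpace.single (1 : Fin 2) (1:ℝ)) =
      fderiv ℝ M₀ a (EuclideanSpace.single (0 : Fin 2) (1:ℝ)) := by
    intro a
    have hsum := sum_fderiv_mollify_eq_zero hA hdiv hρ a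
    rw [Fin.sum_univ_two] at hsum
    have hneg : fderiv ℝ (fun a => -M₁ a) a = -fderiv ℝ M₁ a := by
      have : (fun a => -M₁ a) = -M₁ := rfl
      rw [this, fderiv_neg]
    rw [hneg]
    show -(fderiv ℝ M₁ a (EuclideanSpace.single (1 : Fin 2) (1:ℝ))) = fderiv ℝ M₀ a (EuclideanSpace.single (0 : Fin 2) (1:ℝ))
    linarith
  obtain ⟨f, hf⟩ := exists_potential_of_curlFree hW₀s hM₀s hcurl
  exact ⟨f, (potential_props hW₀s hM₀s hf).1, hf⟩

/-- The potential of `exists_potential_mollified_rot` in coordinates: `∂_v f(a) = −(ρ ⋆ A₁)(a)·v₀ + (ρ ⋆ A₀)(a)·v₁` and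
`‖Df(a)‖² = (ρ ⋆ A₀)(a)² + (ρ ⋆ A₁)(a)²`. [folklore] -/
theorem potential_mollified_rot_props {A : EuclideanSpace ℝ (Fin 2) → EuclideanSpace ℝ (Fin 2)}
    (hA : ∀ k : Fin 2, LocallyIntegrable (fun y => A y k) volume)
    {ρ : EuclideanSpace ℝ (Fin 2) → ℝ} (hρ : IsTestFunctionOn (⊤ : Opens (EuclideanSpace ℝ (Fin 2))) ρ)
    {f : EuclideanSpace ℝ (Fin 2) → ℝ}
    (hf : ∀ a, HasFDerivAt f (innerSL ℝ
        ((-(ρ ⋆[lsmul ℝ ℝ, volume] fun y => A y 1) a) • EuclideanSpace.single (0 : Fin 2) (1:ℝ) +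
          (ρ ⋆[lsmul ℝ ℝ, volume] fun y => A y 0) a • EuclideanSpace.single (1 : Fin 2) (1:ℝ))) a) :
    (∀ a v, fderiv ℝ f a v = -(ρ ⋆[lsmul ℝ ℝ, volume] fun y => A y 1) a * v 0 + (ρ ⋆[lsmul ℝ ℝ, volume] fun y => A y 0) a * v 1) ∧
      ∀ a, ‖fderiv ℝ f a‖ ^ 2 = (ρ ⋆[lsmul ℝ ℝ, volume] fun y => A y 0) a ^ 2 + (ρ ⋆[lsmul ℝ ℝ, volume] fun y => A y 1) a ^ 2 := by
  have hM₀s : ContDiff ℝ 1 (ρ ⋆[lsmul ℝ ℝ, volume] fun y => A y 0) := contDiff_mollify hρ (hA 0)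
  have hM₁s : ContDiff ℝ 1 (ρ ⋆[lsmul ℝ ℝ, volume] fun y => A y 1) := contDiff_mollify hρ (hA 1)
  obtain ⟨-, hfd, hfn⟩ := potential_props hM₁s.neg hM₀s hf
  refine ⟨fun a v => (hfd a v).trans (by ring), fun a => ?_⟩
  have h := hfn a
  rw [neg_sq] at h
  linarith [h]

end Summit.QuantumFields.YangMills.Theorems.PoincareLipschitzPlanarStreamFunctionLetters

end
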